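import Summits.Ventures.CertifiedManyBodySolver.Upper.StripCellHamiltonian
import Summits.Ventures.CertifiedManyBodySolver.Upper.UMPSChargeIdentity
import Summits.Ventures.CertifiedManyBodySolver.Upper.UMPSDualBound
import Summits.Ventures.CertifiedManyBodySolver.Theorems.R2cGcTangentConsumerSpin
import Mathlib.Analysis.Matrix.Order
import Mathlib.Analysis.CStarAlgebra.ContinuousFunctionalCalculus.Order
import HarnessLib

/-!
# Route `R2cOpenStripTangentLine` — the STRIP-CELL uMPS consumer (K1-GATE «writer (ii)», assembly)

HONEST FRAMING: first certified bounds; not a superconductivity verdict; every number certified or labelled float.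
NO NUMBER IS CLAIMED HERE: the leaf-valued theorem is an implication from the data an `a = ∞` strip-cell
certificate asserts (eng-1 `FORMAT-bdstrip-cell-v1`, METHOD-umps Theorem U1 on cells of `c` columns of the
`W`-wide open strip; `proof.conditional` by design).

This file assembles the route pen's `WRITER-II-SPEC.md` (sr-mbsolver-var-7 g16/g17): (α) the column-major cell
presentation `superOp (toSpin H_open((n+2)c × W)) = bondSum n (stripCellBondMatrix κ hc t U) + last cell`
(`Upper/StripCellHamiltonian.lean`), (β) the uMPS tensor side `Re Σ_a ⟨ψ_a, bondSum n X ψ_a⟩ ≤ (n+1)c + 2z`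
(`Upper/UMPSDualBound.lean`, any physical dimension), (γ) the charge identity and its k-free number defect
(`Upper/UMPSChargeIdentity.lean`), and the last-cell bookkeeping (the cell energy is bounded by a natural number
`K`, a k-free constant that never enters the bar), into the three inequalities of the landed sink
`Theorems.m3Upper_tp0_le_m18o25_of_columnMajorSpinFamily` (`Theorems/R2cGcTangentConsumerSpin.lean`):

* `re_star_dotProduct_mulVec_le_of_posSemidef`, `exists_nat_smul_one_sub_posSemidef` — bookkeeping (every Hermitian
  matrix lies below `K·1` for some natural `K`; the last cell's energy is such a k-free constant);
* `superSite_sum_onSite_siteTotalNumber` — the cell particle number is the diagonal `cellCharge` matrix;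
* `stripCell_family_norm`, `stripCell_family_energy_le`, `stripCell_family_number_mem` — for every `k ≥ 1` the
  boundary-propagated mixture `φ_a = (mpsOpen k A e_a r) ∘ superCfg` of `k` cells on the `(k·c) × W` column-major
  box has `Σ‖φ_a‖² = 1`, energy `≤ (k−1)·c_cert + 2|z| + K`, and particle number within `k·Q_c ± (qmax − qmin)`;
* **`m3Upper_tp0_le_m18o25_of_stripCell_umps_dual`** — THE CONSUMER: an exactly left-isometric cell tensor
  `A : Fin Q → M_D(ℂ)` (cell configurations enumerated by any `κ`), a dual `Z`, rationals `c_cert, z` with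
  `c_cert·1 − W(A; hh, Z) ⪰ 0`, `z·1 ∓ Z ⪰ 0` for the strip bond matrix `hh = stripCellBondMatrix κ hc 1 8`, a unit
  boundary vector, integer bond labels obeying the `U(1)` block rule with cell charge `Q_c`, `8·Q_c = 7·W·c`
  (filling `7/8` exactly) and the bar `c_cert/(W·c) ≤ −18/25` ⇒ the rung leaf `M3Upper_tp0_le_m18o25`.

What is NOT here: the Lemma-P layer for ROUNDED (dyadic, nearly isometric) stored tensors (`Upper/UMPSPolarCorrection`
gives the exactly isometric polar tensor and its dual inequality; the transport of the block rule to the polar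
tensor is the remaining piece), the kernel-side integer checks of a concrete certificate file, `t' ≠ 0`.
Sources: route pen's `WRITER-II-SPEC.md`; VAR `METHOD-umps.md` Thm U1; Ruelle (1969) §3.4 (the sink) [Ruelle1969];
Fannes–Nachtergaele–Werner (1992) [FannesNachtergaeleWernerCMP1992].
-/

noncomputable section

open Matrix Finset
open scoped ComplexOrder BigOperators Kronecker

namespace Summit.Ventures.CertifiedManyBodySolver.Theorems

open Literature.MathematicalPhysics.QuantumLattice
open Literature.MathematicalPhysics.QuantumLattice.JordanWigner
open Summit.Ventures.CertifiedManyBodySolver.Upper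

/-! ### Bookkeeping -/

/-- `Re ⟨ψ, O ψ⟩ ≤ K·‖ψ‖²` whenever `K·1 − O ⪰ 0`. [folklore] -/
theorem re_star_dotProduct_mulVec_le_of_posSemidef {m : Type*} [Fintype m] [DecidableEq m]
    {O : Matrix m m ℂ} {K : ℝ} (h : (((K : ℝ) : ℂ) • (1 : Matrix m m ℂ) - O).PosSemidef) (ψ : m → ℂ) :
    (star ψ ⬝ᵥ (O *ᵥ ψ)).re ≤ K * (star ψ ⬝ᵥ ψ).re := by
  have h' := h.re_dotProduct_nonneg ψ
  rw [Matrix.sub_mulVec, Matrix.smul_mulVec, Matrix.one_mulVec, dotProduct_sub, dotProduct_smul,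
    smul_eq_mul, RCLike.re_to_complex, Complex.sub_re, Complex.re_ofReal_mul] at h'
  linarith

section NormCeiling

open scoped MatrixOrder

/-- **Every Hermitian matrix lies below some natural multiple of the identity**: `K·1 − H ⪰ 0` with
`K = ⌈Σ_i |λ_i(H)|⌉` (spectral theorem through the continuous functional calculus order lemma
`le_algebraMap_of_spectrum_le`; only the existence of `K` is used downstream). [folklore] -/
theorem exists_nat_smul_one_sub_posSemidef {m : Type*} [Fintype m] [DecidableEq m] (H : Matrix m m ℂ)
    (hH : H.IsHermitian) : ∃ K : ℕ, ((((K : ℕ) : ℝ) : ℂ) • (1 : Matrix m m ℂ) - H).PosSemidef := by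
  set r : ℝ := ∑ i, |hH.eigenvalues i| with hr
  have hle : H ≤ algebraMap ℝ (Matrix m m ℂ) r := by
    refine le_algebraMap_of_spectrum_le (fun x hx => ?_) hH.isSelfAdjoint
    rw [hH.spectrum_real_eq_range_eigenvalues] at hx
    obtain ⟨i, rfl⟩ := hx
    exact (le_abs_self _).trans
      (Finset.single_le_sum (fun j _ => abs_nonneg (hH.eigenvalues j)) (Finset.mem_univ i))
  rw [Matrix.le_iff] at hle
  have hmap : algebraMap ℝ (Matrix m m ℂ) r = ((r : ℝ) : ℂ) • (1 : Matrix m m ℂ) := by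
    rw [Algebra.algebraMap_eq_smul_one]
    ext i j
    simp [Matrix.smul_apply, Complex.real_smul]
  rw [hmap] at hle
  refine ⟨⌈r⌉₊, ?_⟩
  have h2 : (0 : ℝ) ≤ ((⌈r⌉₊ : ℕ) : ℝ) - r := sub_nonneg.2 (Nat.le_ceil _)
  have h3 : (((⌈r⌉₊ : ℕ) : ℝ) : ℂ) • (1 : Matrix m m ℂ) - H =
      ((((⌈r⌉₊ : ℕ) : ℝ) - r : ℝ) : ℂ) • (1 : Matrix m m ℂ) + (((r : ℝ) : ℂ) • (1 : Matrix m m ℂ) - H) := by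
    rw [Complex.ofReal_sub, sub_smul]
    abel
  rw [h3]
  exact (Matrix.PosSemidef.one.smul (Complex.zero_le_real.2 h2)).add hle

end NormCeiling

/-! ### The cell particle number is diagonal -/

/-- A diagonal one-site matrix placed at a site is diagonal. [folklore] -/
theorem onSite_diagonal {F : Type*} [Fintype F] [DecidableEq F] {q : ℕ} (f : F) (d : Fin q → ℂ) :
    (onSite f (diagonal d) : Op F q) = diagonal fun σ => d (σ f) := by
  ext σ τ
  rw [onSite_apply, diagonal_apply, diagonal_apply]
  by_cases h : σ = τ
  · subst h
    simp
  · rw [if_neg h]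
    by_cases h' : ∀ y, y ≠ f → σ y = τ y
    · rw [if_pos h', if_neg]
      intro hf
      exact h (funext fun y => if hy : y = f then hy ▸ hf else h' y hy)
    · rw [if_neg h']

/-- **The cell particle number as a super-site matrix**: `superSite κ (Σ_f (n_↑+n_↓)_f) = diag(cellCharge)` with
the cell charge `S ↦ Σ_f siteCharge (κ⁻¹ S f)`. [folklore] -/
theorem superSite_sum_onSite_siteTotalNumber {F : Type*} [Fintype F] [DecidableEq F] {Q : ℕ}
    (κ : TensorIndex F 4 ≃ Fin Q) :
    superSite κ (∑ f : F, onSite f siteTotalNumber) =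
      diagonal fun S => (((∑ f, siteCharge (κ.symm S f) : ℕ) : ℤ) : ℂ) := by
  ext S S'
  rw [superSite_apply, Matrix.sum_apply, diagonal_apply]
  simp only [siteTotalNumber, onSite_diagonal, diagonal_apply, EmbeddingLike.apply_eq_iff_eq]
  split_ifs with h
  · push_cast
    rfl
  · simp

/-- `superSite κ (toSpin 1) = 1` (both maps are unital; written entrywise to stay clear of the instance path of
the spin-side identity). [folklore] -/
theorem superSite_toSpin_one {Λ : Type*} [LinearOrder Λ] [Fintype Λ] {Q : ℕ} (κ : TensorIndex Λ 4 ≃ Fin Q) :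
    superSite κ (toSpin (1 : Matrix (Finset (Orb Λ)) (Finset (Orb Λ)) ℂ)) = 1 := by
  ext S S'
  rw [superSite_apply, toSpin_apply, Matrix.one_apply, Matrix.one_apply]
  have h : config (κ.symm S) = config (κ.symm S') ↔ S = S' := by
    constructor
    · intro h'
      exact κ.symm.injective ((JordanWigner.configEquiv (Λ := Λ)).injective h')
    · rintro rfl
      rfl
  simp only [h]

/-! ### The strip-cell family: norm, energy, particle number -/

variable {W c Q D : ℕ}

/-- **Norm of the family**: `Σ_a ‖(mpsOpen k A e_a r) ∘ superCfg‖² = ‖r‖²` for a left-isometric cell tensor. -/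
theorem stripCell_family_norm (κ : TensorIndex (Fin c ×ₗ Fin W) 4 ≃ Fin Q) {A : MPSTensor Q D}
    (hA : ∑ S, (A S)ᴴ * A S = 1) (r : Fin D → ℂ) (k : ℕ) :
    ∑ l : Fin D, star (fun σ => mpsOpen k A (Pi.single l 1) r (superCfg (stripCells k c W) κ σ)) ⬝ᵥ
        (fun σ => mpsOpen k A (Pi.single l 1) r (superCfg (stripCells k c W) κ σ)) = star r ⬝ᵥ r := by
  simp only [star_comp_superCfg_dotProduct_self]
  exact sum_star_mpsOpen_dotProduct_mpsOpen_eq hA k r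

/-- **Energy of the family** (METHOD-umps U1 on the strip, `k ≥ 1` cells): with `c_cert·1 − W(A; hh, Z) ⪰ 0`,
`z·1 ∓ Z ⪰ 0`, `‖r‖ = 1`, and `K·1 − superSite κ (toSpin H_open(c × W)) ⪰ 0`,
`Σ_a Re⟨φ_a, toSpin H_open((k·c) × W) φ_a⟩ ≤ (k − 1)·c_cert + 2|z| + K`. -/
theorem stripCell_family_energy_le (hc : 0 < c) (κ : TensorIndex (Fin c ×ₗ Fin W) 4 ≃ Fin Q)
    {A : MPSTensor Q D} (hA : ∑ S, (A S)ᴴ * A S = 1) {r : Fin D → ℂ} (hr : star r ⬝ᵥ r = 1)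
    (Z : Matrix (Fin D) (Fin D) ℂ) (t : ℝ) {U cc z K : ℝ}
    (hdual : (((cc : ℝ) : ℂ) • (1 : Matrix (Fin D) (Fin D) ℂ) -
      dualMatrix A (stripCellBondMatrix κ hc t U) Z).PosSemidef)
    (hZ₁ : (((z : ℝ) : ℂ) • (1 : Matrix (Fin D) (Fin D) ℂ) - Z).PosSemidef)
    (hZ₂ : (((z : ℝ) : ℂ) • (1 : Matrix (Fin D) (Fin D) ℂ) + Z).PosSemidef)
    (hK : (((K : ℝ) : ℂ) • (1 : Matrix (Fin Q) (Fin Q) ℂ) -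
      superSite κ (toSpin (hubbardOpenBoxTT' c W t 0 U))).PosSemidef)
    (k : ℕ) (hk : 1 ≤ k) :
    ∑ l : Fin D, (star (fun σ => mpsOpen k A (Pi.single l 1) r (superCfg (stripCells k c W) κ σ)) ⬝ᵥ
        (toSpin (hubbardOpenBoxTT' (k * c) W t 0 U) *ᵥ
          fun σ => mpsOpen k A (Pi.single l 1) r (superCfg (stripCells k c W) κ σ))).re ≤
      ((k : ℝ) - 1) * cc + 2 * |z| + K := by
  -- the last-cell one-site operator is bounded by `K`
  have hlast : ∀ (C : ℕ) (b : Fin C), (((K : ℝ) : ℂ) • (1 : Op (Fin C) Q) -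
      onSite b (superSite κ (toSpin (hubbardOpenBoxTT' c W t 0 U)))).PosSemidef := by
    intro C b
    have h : (((K : ℝ) : ℂ) • (1 : Op (Fin C) Q) - onSite b (superSite κ (toSpin (hubbardOpenBoxTT' c W t 0 U)))) =
        onSite b ((((K : ℝ) : ℂ) • (1 : Matrix (Fin Q) (Fin Q) ℂ) -
          superSite κ (toSpin (hubbardOpenBoxTT' c W t 0 U)))) := by
      rw [onSite_sub', onSite_smul', onSite_one']
    rw [h]
    exact onSite_posSemidef b hK
  have hz0 : z ≤ |z| := le_abs_self z
  simp only [star_comp_superCfg_dotProduct_mulVec]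
  rcases (show k = 1 ∨ ∃ n, k = n + 2 by
      rcases k with _ | _ | n <;> [omega; exact Or.inl rfl; exact Or.inr ⟨n, rfl⟩]) with rfl | ⟨n, rfl⟩
  · -- one cell: only the last-cell term
    rw [superOp_toSpin_hubbardOpenBoxTT' hc κ t U]
    simp only [Fin.sum_univ_one, Fin.val_zero, zero_add, one_ne_zero, if_false, smul_zero, add_zero]
    have h1 : ∀ l : Fin D, (star (mpsOpen 1 A (Pi.single l 1) r) ⬝ᵥ
        (onSite (0 : Fin 1) (superSite κ (toSpin (hubbardOpenBoxTT' c W t 0 U))) *ᵥ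
          mpsOpen 1 A (Pi.single l 1) r)).re ≤ K * (star (mpsOpen 1 A (Pi.single l 1) r) ⬝ᵥ
            mpsOpen 1 A (Pi.single l 1) r).re := fun l =>
      re_star_dotProduct_mulVec_le_of_posSemidef (hlast 1 0) _
    have h2 : ∑ l : Fin D, (star (mpsOpen 1 A (Pi.single l 1) r) ⬝ᵥ mpsOpen 1 A (Pi.single l 1) r).re = 1 := by
      rw [← Complex.re_sum, sum_star_mpsOpen_dotProduct_mpsOpen_eq hA 1 r, hr, Complex.one_re]
    calc ∑ l : Fin D, (star (mpsOpen 1 A (Pi.single l 1) r) ⬝ᵥ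
          (onSite (0 : Fin 1) (superSite κ (toSpin (hubbardOpenBoxTT' c W t 0 U))) *ᵥ
            mpsOpen 1 A (Pi.single l 1) r)).re
        ≤ ∑ l : Fin D, K * (star (mpsOpen 1 A (Pi.single l 1) r) ⬝ᵥ mpsOpen 1 A (Pi.single l 1) r).re :=
          Finset.sum_le_sum fun l _ => h1 l
      _ = K := by rw [← Finset.mul_sum, h2, mul_one]
      _ ≤ (((1 : ℕ) : ℝ) - 1) * cc + 2 * |z| + K := by push_cast; nlinarith [abs_nonneg z]
  · -- `n + 2` cells: the bond sum (tensor side) and the last cell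
    rw [superOp_toSpin_hubbardOpenBoxTT'_eq_bondSum n hc κ t U]
    simp only [Matrix.add_mulVec, dotProduct_add, Complex.add_re, Finset.sum_add_distrib]
    have hB := re_sum_star_mpsOpen_dotProduct_bondSum_mulVec_le hA hr (stripCellBondMatrix κ hc t U) Z
      hdual hZ₁ hZ₂ n
    rw [Complex.re_sum] at hB
    have h1 : ∀ l : Fin D, (star (mpsOpen (n + 2) A (Pi.single l 1) r) ⬝ᵥ
        (onSite (Fin.last (n + 1)) (superSite κ (toSpin (hubbardOpenBoxTT' c W t 0 U))) *ᵥ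
          mpsOpen (n + 2) A (Pi.single l 1) r)).re ≤ K * (star (mpsOpen (n + 2) A (Pi.single l 1) r) ⬝ᵥ
            mpsOpen (n + 2) A (Pi.single l 1) r).re := fun l =>
      re_star_dotProduct_mulVec_le_of_posSemidef (hlast (n + 2) (Fin.last (n + 1))) _
    have h2 : ∑ l : Fin D, (star (mpsOpen (n + 2) A (Pi.single l 1) r) ⬝ᵥ
        mpsOpen (n + 2) A (Pi.single l 1) r).re = 1 := by
      rw [← Complex.re_sum, sum_star_mpsOpen_dotProduct_mpsOpen_eq hA (n + 2) r, hr, Complex.one_re]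
    have hL : ∑ l : Fin D, (star (mpsOpen (n + 2) A (Pi.single l 1) r) ⬝ᵥ
        (onSite (Fin.last (n + 1)) (superSite κ (toSpin (hubbardOpenBoxTT' c W t 0 U))) *ᵥ
          mpsOpen (n + 2) A (Pi.single l 1) r)).re ≤ K :=
      calc _ ≤ ∑ l : Fin D, K * (star (mpsOpen (n + 2) A (Pi.single l 1) r) ⬝ᵥ
              mpsOpen (n + 2) A (Pi.single l 1) r).re := Finset.sum_le_sum fun l _ => h1 l
        _ = K := by rw [← Finset.mul_sum, h2, mul_one]
    push_cast
    nlinarith [hB, hL, hz0]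

/-- **Particle number of the family** (the charge identity, `Upper/UMPSChargeIdentity.lean`): with the `U(1)`
block rule `A S α β ≠ 0 → lab β + Q_c = lab α + cellCharge S` and labels in `[qmin, qmax]`, `‖r‖ = 1`:
`k·Q_c − (qmax − qmin) ≤ Σ_a Re⟨φ_a, N̂ φ_a⟩ ≤ k·Q_c + (qmax − qmin)` on the `(k·c) × W` box. -/
theorem stripCell_family_number_mem (κ : TensorIndex (Fin c ×ₗ Fin W) 4 ≃ Fin Q) {A : MPSTensor Q D}
    (hA : ∑ S, (A S)ᴴ * A S = 1) {r : Fin D → ℂ} (hr : star r ⬝ᵥ r = 1) (lab : Fin D → ℤ)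
    (Qc : ℤ) (hBC : ∀ (S : Fin Q) (α β : Fin D), A S α β ≠ 0 →
      lab β + Qc = lab α + ((∑ f, siteCharge (κ.symm S f) : ℕ) : ℤ))
    {qmin qmax : ℤ} (hlab : ∀ α, qmin ≤ lab α ∧ lab α ≤ qmax) (k : ℕ) :
    (k : ℝ) * ((Qc : ℤ) : ℝ) - (((qmax : ℤ) : ℝ) - ((qmin : ℤ) : ℝ)) ≤
        ∑ l : Fin D, (star (fun σ => mpsOpen k A (Pi.single l 1) r (superCfg (stripCells k c W) κ σ)) ⬝ᵥ
          ((∑ x : Fin (k * c) ×ₗ Fin W, onSite x siteTotalNumber) *ᵥ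
            fun σ => mpsOpen k A (Pi.single l 1) r (superCfg (stripCells k c W) κ σ))).re ∧
      ∑ l : Fin D, (star (fun σ => mpsOpen k A (Pi.single l 1) r (superCfg (stripCells k c W) κ σ)) ⬝ᵥ
          ((∑ x : Fin (k * c) ×ₗ Fin W, onSite x siteTotalNumber) *ᵥ
            fun σ => mpsOpen k A (Pi.single l 1) r (superCfg (stripCells k c W) κ σ))).re ≤
        (k : ℝ) * ((Qc : ℤ) : ℝ) + (((qmax : ℤ) : ℝ) - ((qmin : ℤ) : ℝ)) := by
  simp only [star_comp_superCfg_dotProduct_mulVec, superOp_sum_onSite_siteTotalNumber,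
    superSite_sum_onSite_siteTotalNumber]
  have h := re_sum_star_mpsOpen_dotProduct_sum_onSite_charge_mem hA hr k
    (fun S => ((∑ f, siteCharge (κ.symm S f) : ℕ) : ℤ)) lab Qc hBC hlab
  simp only [Complex.re_sum] at h
  exact h

/-! ### The consumer -/

/-- **STRIP-CELL uMPS CONSUMER (K1-GATE «writer (ii)»).** DATA of an `a = ∞` strip-cell certificate (METHOD-umps U1
on cells of `c ≥ 1` columns of the `W ≥ 1`-wide open strip, `(t, t′, U) = (1, 0, 8)`, `μ = 0`): an enumeration `κ`
of the cell configurations, an EXACTLY left-isometric cell tensor `A : Fin Q → M_D(ℂ)`, a unit boundary vector `r`,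
a dual matrix `Z` and rationals `c_cert, z` with `c_cert·1 − W(A; stripCellBondMatrix κ hc 1 8, Z) ⪰ 0`,
`z·1 − Z ⪰ 0`, `z·1 + Z ⪰ 0`; integer bond labels `lab ∈ [qmin, qmax]` obeying the `U(1)` block rule with cell
charge `Q_c` (every nonzero entry `A S α β` has `lab β + Q_c = lab α + cellCharge S`), filling `7/8` exactly
(`8·Q_c = 7·W·c`), and the bar `c_cert/(W·c) ≤ −18/25`. THEN the rung leaf `e(1, 0, 8, 7/8) ≤ −18/25` holds, via the
column-major all-`k` family `φ_a = (mpsOpen k A e_a r) ∘ superCfg` (norm `1`, energy `≤ (k−1)c_cert + 2|z| + K` with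
`K·1 ≥ H_cell`, particle number `k·Q_c ± (qmax − qmin)`) and the landed sink `m3Upper_tp0_le_m18o25_of_columnMajorSpinFamily`
with `E = 2|z| + K`, `Δ = c_cert − E`, `q = qmax − qmin`. [cite: Ruelle1969, §3.4] -/
theorem m3Upper_tp0_le_m18o25_of_stripCell_umps_dual (W c : ℕ) (hW : 1 ≤ W) (hc : 0 < c)
    (κ : TensorIndex (Fin c ×ₗ Fin W) 4 ≃ Fin Q) (A : MPSTensor Q D) (hA : ∑ S, (A S)ᴴ * A S = 1)
    (r : Fin D → ℂ) (hr : star r ⬝ᵥ r = 1) (Z : Matrix (Fin D) (Fin D) ℂ) (cc z : ℚ)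
    (hdual : ((((cc : ℚ) : ℝ) : ℂ) • (1 : Matrix (Fin D) (Fin D) ℂ) -
      dualMatrix A (stripCellBondMatrix κ hc 1 8) Z).PosSemidef)
    (hZ₁ : ((((z : ℚ) : ℝ) : ℂ) • (1 : Matrix (Fin D) (Fin D) ℂ) - Z).PosSemidef)
    (hZ₂ : ((((z : ℚ) : ℝ) : ℂ) • (1 : Matrix (Fin D) (Fin D) ℂ) + Z).PosSemidef)
    (lab : Fin D → ℤ) (Qc qmin qmax : ℤ)
    (hBC : ∀ (S : Fin Q) (α β : Fin D), A S α β ≠ 0 →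
      lab β + Qc = lab α + ((∑ f, siteCharge (κ.symm S f) : ℕ) : ℤ))
    (hlab : ∀ α, qmin ≤ lab α ∧ lab α ≤ qmax) (hQc : (8 : ℤ) * Qc = 7 * ((W : ℤ) * (c : ℤ)))
    (hbar : cc / ((W : ℚ) * (c : ℚ)) ≤ -18 / 25) :
    Summit.Ventures.CertifiedManyBodySolver.MbsolverRungLeaves.M3Upper_tp0_le_m18o25 := by
  -- the last-cell constant `K` with `K·1 − H_open(c × W) ⪰ 0`
  obtain ⟨K, hK₀⟩ := exists_nat_smul_one_sub_posSemidef (hubbardOpenBoxTT' c W 1 0 8)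
    (hubbardOpenBoxTT'_isHermitian c W 1 0 8)
  have hK : ((((K : ℕ) : ℝ) : ℂ) • (1 : Matrix (Fin Q) (Fin Q) ℂ) -
      superSite κ (toSpin (hubbardOpenBoxTT' c W 1 0 8))).PosSemidef := by
    have h1 : superSite κ (toSpin ((((K : ℕ) : ℝ) : ℂ) •
        (1 : Matrix (Finset (Orb (Fin c ×ₗ Fin W))) (Finset (Orb (Fin c ×ₗ Fin W))) ℂ) - hubbardOpenBoxTT' c W 1 0 8)) =
        (((K : ℕ) : ℝ) : ℂ) • (1 : Matrix (Fin Q) (Fin Q) ℂ) - superSite κ (toSpin (hubbardOpenBoxTT' c W 1 0 8)) := by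
      rw [map_sub, map_smul, map_sub, map_smul, superSite_toSpin_one]
    rw [← h1, posSemidef_superSite_iff, posSemidef_toSpin_iff]
    exact hK₀
  have hQc' : ((Qc : ℤ) : ℝ) = 7 / 8 * ((W : ℝ) * (c : ℝ)) := by
    have : (8 : ℝ) * ((Qc : ℤ) : ℝ) = 7 * ((W : ℝ) * (c : ℝ)) := by exact_mod_cast hQc
    linarith
  refine m3Upper_tp0_le_m18o25_of_columnMajorSpinFamily W c (2 * |z| + K) (cc - (2 * |z| + K))
    ((qmax : ℚ) - qmin) hW hc ?_ ?_
  · have h : 2 * |z| + (K : ℚ) + (cc - (2 * |z| + K)) = cc := by ring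
    rw [h]
    exact hbar
  · intro k hk
    have hS : ∑ l : Fin D, (star (fun σ => mpsOpen k A (Pi.single l 1) r (superCfg (stripCells k c W) κ σ)) ⬝ᵥ
        (fun σ => mpsOpen k A (Pi.single l 1) r (superCfg (stripCells k c W) κ σ))).re = 1 := by
      rw [← Complex.re_sum, stripCell_family_norm κ hA r k, hr, Complex.one_re]
    refine ⟨D, fun l σ => mpsOpen k A (Pi.single l 1) r (superCfg (stripCells k c W) κ σ), ?_, ?_, ?_, ?_⟩
    · -- norm
      dsimp only
      rw [hS]
      exact one_pos
    · -- energy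
      dsimp only
      have hE := stripCell_family_energy_le hc κ hA hr Z 1 (U := 8) (cc := (cc : ℝ)) (z := (z : ℝ)) (K := (K : ℝ))
        hdual hZ₁ hZ₂ hK k hk
      rw [hS, mul_one]
      refine hE.trans (le_of_eq ?_)
      push_cast
      ring
    · -- particle number, lower
      dsimp only
      have hN := (stripCell_family_number_mem κ hA hr lab Qc hBC hlab k).1
      rw [hS, mul_one]
      refine le_trans (le_of_eq ?_) hN
      push_cast
      rw [hQc']
      ring
    · -- particle number, upper
      dsimp only
      have hN := (stripCell_family_number_mem κ hA hr lab Qc hBC hlab k).2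
      rw [hS, mul_one]
      refine hN.trans (le_of_eq ?_)
      push_cast
      rw [hQc']
      ring

end Summit.Ventures.CertifiedManyBodySolver.Theorems

end
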